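import Summits.MatrixMultiplication.MatrixMultiplication.Theorems.SoloInformedTwistedMatchingsEffectiveExponentHeadline
import HarnessLib

/-!
# Effective Theorem B″: the certified level conditions as lemmas, and the table of unconditional instances

Solo-informed seat (MatrixMultiplication), gen 101; sharpest-statement §2y(8). The five certified level
conditions `θ_p(u^{(p+1)^s}) ≤ p^r` (`s < E`) as standalone lemmas — `(p,E,u,r)` =
`(2,1,1/2,23/25)`, `(3,1,3/5,14/15)`, `(2,2,3/4,19/20)`, `(5,1,7/10,15/16)`, `(3,2,4/5,24/25)` — and the
resulting unconditional instances of `twistedMatching_card_le_effective_of_exponent` (group level) and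
`translationScheme_effective_of_exponent` (CU13 translation schemes) for exponents `3m'`, `4m'`, `5m'`,
`9m'` (`m'` coprime to the prime): `|ι| ≤ 3 t |S_p|^r`, resp. a realization of `⟨3N,3N,3N⟩` in `𝒮(S,M₀)`
forces `N² e^{-4√(log N)} ≤ 3 t |S_p|^r` with `|S_p| t = |S| ≤ |C|·|M₀|`.
-/

noncomputable section

open scoped BigOperators
open Finset

namespace Summit.MatrixMultiplication.MatrixMultiplication.Theorems.TwistedSliceRank

section EffectiveTable

/-- Certified level condition(s) `θ_p(u^{(p+1)^s}) ≤ p^r`. [this work] -/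
theorem levelCond_two_one : ∀ s : ℕ, s < 1 →
    (1 / 2 : ℝ) ^ (-(((2 - 1 : ℕ) : ℝ)) * (((2 : ℕ) : ℝ) + 1) ^ s / 3) *
      ∑ j : Fin 2, (1 / 2 : ℝ) ^ (((j : ℕ) : ℝ) * (((2 : ℕ) : ℝ) + 1) ^ s) ≤
        ((2 : ℕ) : ℝ) ^ (23 / 25 : ℝ) := by
  intro s hs
  interval_cases s
  rw [Fin.sum_univ_two, Fin.val_zero, Fin.val_one]
  norm_num
  rw [one_div (2 : ℝ), Real.inv_rpow (by norm_num), Real.rpow_neg (by norm_num), inv_inv]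
  have h75 : ((2 : ℝ) ^ ((1 : ℝ) / 3) * (3 / 2)) ^ (75 : ℕ) ≤ ((2 : ℝ) ^ ((23 : ℝ) / 25)) ^ (75 : ℕ) := by
    rw [mul_pow, ← Real.rpow_natCast ((2 : ℝ) ^ ((1 : ℝ) / 3)) 75,
      ← Real.rpow_mul (by norm_num), ← Real.rpow_natCast ((2 : ℝ) ^ ((23 : ℝ) / 25)) 75,
      ← Real.rpow_mul (by norm_num),
      show ((1 : ℝ) / 3 * ((75 : ℕ) : ℝ)) = ((25 : ℕ) : ℝ) by norm_num,
      show ((23 : ℝ) / 25 * ((75 : ℕ) : ℝ)) = ((69 : ℕ) : ℝ) by norm_num,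
      Real.rpow_natCast, Real.rpow_natCast]
    norm_num
  exact le_of_pow_le_pow_left₀ (by norm_num) (by positivity) h75

/-- Certified level condition(s) `θ_p(u^{(p+1)^s}) ≤ p^r`. [this work] -/
theorem levelCond_three_one : ∀ s : ℕ, s < 1 →
    (3 / 5 : ℝ) ^ (-(((3 - 1 : ℕ) : ℝ)) * (((3 : ℕ) : ℝ) + 1) ^ s / 3) *
      ∑ j : Fin 3, (3 / 5 : ℝ) ^ (((j : ℕ) : ℝ) * (((3 : ℕ) : ℝ) + 1) ^ s) ≤
        ((3 : ℕ) : ℝ) ^ (14 / 15 : ℝ) := by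
  intro s hs
  interval_cases s
  simp only [Fin.sum_univ_three, Fin.val_zero, Fin.val_one, Fin.val_two, Fin.isValue]
  norm_num
  rw [show ((3 : ℝ) / 5) = ((5 : ℝ) / 3)⁻¹ by norm_num, Real.inv_rpow (by norm_num),
    Real.rpow_neg (by norm_num), inv_inv]
  have h15 : (((5 : ℝ) / 3) ^ ((2 : ℝ) / 3) * (49 / 25)) ^ (15 : ℕ) ≤
      ((3 : ℝ) ^ ((14 : ℝ) / 15)) ^ (15 : ℕ) := by
    rw [mul_pow, ← Real.rpow_natCast (((5 : ℝ) / 3) ^ ((2 : ℝ) / 3)) 15,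
      ← Real.rpow_mul (by norm_num), ← Real.rpow_natCast ((3 : ℝ) ^ ((14 : ℝ) / 15)) 15,
      ← Real.rpow_mul (by norm_num),
      show ((2 : ℝ) / 3 * ((15 : ℕ) : ℝ)) = ((10 : ℕ) : ℝ) by norm_num,
      show ((14 : ℝ) / 15 * ((15 : ℕ) : ℝ)) = ((14 : ℕ) : ℝ) by norm_num,
      Real.rpow_natCast, Real.rpow_natCast]
    norm_num
  have := le_of_pow_le_pow_left₀ (by norm_num) (by positivity) h15
  exact this

/-- Certified level condition(s) `θ_p(u^{(p+1)^s}) ≤ p^r`. [this work] -/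
theorem levelCond_two_two : ∀ s : ℕ, s < 2 →
    (3 / 4 : ℝ) ^ (-(((2 - 1 : ℕ) : ℝ)) * (((2 : ℕ) : ℝ) + 1) ^ s / 3) *
      ∑ j : Fin 2, (3 / 4 : ℝ) ^ (((j : ℕ) : ℝ) * (((2 : ℕ) : ℝ) + 1) ^ s) ≤
        ((2 : ℕ) : ℝ) ^ (19 / 20 : ℝ) := by
  intro s hs
  interval_cases s
  · rw [Fin.sum_univ_two, Fin.val_zero, Fin.val_one]
    norm_num
    rw [show ((3 : ℝ) / 4) = ((4 : ℝ) / 3)⁻¹ by norm_num, Real.inv_rpow (by norm_num),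
      Real.rpow_neg (by norm_num), inv_inv]
    have h60 : (((4 : ℝ) / 3) ^ ((1 : ℝ) / 3) * (7 / 4)) ^ (60 : ℕ) ≤
        ((2 : ℝ) ^ ((19 : ℝ) / 20)) ^ (60 : ℕ) := by
      rw [mul_pow, ← Real.rpow_natCast (((4 : ℝ) / 3) ^ ((1 : ℝ) / 3)) 60,
        ← Real.rpow_mul (by norm_num), ← Real.rpow_natCast ((2 : ℝ) ^ ((19 : ℝ) / 20)) 60,
        ← Real.rpow_mul (by norm_num),
        show ((1 : ℝ) / 3 * ((60 : ℕ) : ℝ)) = ((20 : ℕ) : ℝ) by norm_num,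
        show ((19 : ℝ) / 20 * ((60 : ℕ) : ℝ)) = ((57 : ℕ) : ℝ) by norm_num,
        Real.rpow_natCast, Real.rpow_natCast]
      norm_num
    have := le_of_pow_le_pow_left₀ (by norm_num) (by positivity) h60
    linarith
  · rw [Fin.sum_univ_two, Fin.val_zero, Fin.val_one]
    norm_num
    have h20 : ((91 : ℝ) / 48) ^ (20 : ℕ) ≤ ((2 : ℝ) ^ ((19 : ℝ) / 20)) ^ (20 : ℕ) := by
      rw [← Real.rpow_natCast ((2 : ℝ) ^ ((19 : ℝ) / 20)) 20, ← Real.rpow_mul (by norm_num),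
        show ((19 : ℝ) / 20 * ((20 : ℕ) : ℝ)) = ((19 : ℕ) : ℝ) by norm_num, Real.rpow_natCast]
      norm_num
    have := le_of_pow_le_pow_left₀ (by norm_num) (by positivity) h20
    exact this

/-- Certified level condition(s) `θ_p(u^{(p+1)^s}) ≤ p^r`. [this work] -/
theorem levelCond_five_one : ∀ s : ℕ, s < 1 →
    (7 / 10 : ℝ) ^ (-(((5 - 1 : ℕ) : ℝ)) * (((5 : ℕ) : ℝ) + 1) ^ s / 3) *
      ∑ j : Fin 5, (7 / 10 : ℝ) ^ (((j : ℕ) : ℝ) * (((5 : ℕ) : ℝ) + 1) ^ s) ≤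
        ((5 : ℕ) : ℝ) ^ (15 / 16 : ℝ) := by
  intro s hs
  interval_cases s
  simp only [Fin.sum_univ_five, Fin.val_zero, Fin.val_one, Fin.val_two, Fin.isValue,
    show ((3 : Fin 5) : ℕ) = 3 from rfl, show ((4 : Fin 5) : ℕ) = 4 from rfl]
  norm_num
  rw [show ((7 : ℝ) / 10) = ((10 : ℝ) / 7)⁻¹ by norm_num, Real.inv_rpow (by norm_num),
    Real.rpow_neg (by norm_num), inv_inv]
  have h48 : (((10 : ℝ) / 7) ^ ((4 : ℝ) / 3) * (27731 / 10000)) ^ (48 : ℕ) ≤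
      ((5 : ℝ) ^ ((15 : ℝ) / 16)) ^ (48 : ℕ) := by
    rw [mul_pow, ← Real.rpow_natCast (((10 : ℝ) / 7) ^ ((4 : ℝ) / 3)) 48,
      ← Real.rpow_mul (by norm_num), ← Real.rpow_natCast ((5 : ℝ) ^ ((15 : ℝ) / 16)) 48,
      ← Real.rpow_mul (by norm_num),
      show ((4 : ℝ) / 3 * ((48 : ℕ) : ℝ)) = ((64 : ℕ) : ℝ) by norm_num,
      show ((15 : ℝ) / 16 * ((48 : ℕ) : ℝ)) = ((45 : ℕ) : ℝ) by norm_num,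
      Real.rpow_natCast, Real.rpow_natCast]
    norm_num
  have := le_of_pow_le_pow_left₀ (by norm_num) (by positivity) h48
  exact this

/-- Certified level condition(s) `θ_p(u^{(p+1)^s}) ≤ p^r`. [this work] -/
theorem levelCond_three_two : ∀ s : ℕ, s < 2 →
    (4 / 5 : ℝ) ^ (-(((3 - 1 : ℕ) : ℝ)) * (((3 : ℕ) : ℝ) + 1) ^ s / 3) *
      ∑ j : Fin 3, (4 / 5 : ℝ) ^ (((j : ℕ) : ℝ) * (((3 : ℕ) : ℝ) + 1) ^ s) ≤
        ((3 : ℕ) : ℝ) ^ (24 / 25 : ℝ) := by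
  intro s hs
  interval_cases s
  · simp only [Fin.sum_univ_three, Fin.val_zero, Fin.val_one, Fin.val_two, Fin.isValue]
    norm_num
    rw [show ((4 : ℝ) / 5) = ((5 : ℝ) / 4)⁻¹ by norm_num, Real.inv_rpow (by norm_num),
      Real.rpow_neg (by norm_num), inv_inv]
    have h75 : (((5 : ℝ) / 4) ^ ((2 : ℝ) / 3) * (61 / 25)) ^ (75 : ℕ) ≤
        ((3 : ℝ) ^ ((24 : ℝ) / 25)) ^ (75 : ℕ) := by
      rw [mul_pow, ← Real.rpow_natCast (((5 : ℝ) / 4) ^ ((2 : ℝ) / 3)) 75,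
        ← Real.rpow_mul (by norm_num), ← Real.rpow_natCast ((3 : ℝ) ^ ((24 : ℝ) / 25)) 75,
        ← Real.rpow_mul (by norm_num),
        show ((2 : ℝ) / 3 * ((75 : ℕ) : ℝ)) = ((50 : ℕ) : ℝ) by norm_num,
        show ((24 : ℝ) / 25 * ((75 : ℕ) : ℝ)) = ((72 : ℕ) : ℝ) by norm_num,
        Real.rpow_natCast, Real.rpow_natCast]
      norm_num
    have := le_of_pow_le_pow_left₀ (by norm_num) (by positivity) h75
    exact this
  · simp only [Fin.sum_univ_three, Fin.val_zero, Fin.val_one, Fin.val_two, Fin.isValue]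
    norm_num
    rw [show ((4 : ℝ) / 5) = ((5 : ℝ) / 4)⁻¹ by norm_num, Real.inv_rpow (by norm_num),
      Real.rpow_neg (by norm_num), inv_inv]
    have h75 : (((5 : ℝ) / 4) ^ ((8 : ℝ) / 3) * (616161 / 390625)) ^ (75 : ℕ) ≤
        ((3 : ℝ) ^ ((24 : ℝ) / 25)) ^ (75 : ℕ) := by
      rw [mul_pow, ← Real.rpow_natCast (((5 : ℝ) / 4) ^ ((8 : ℝ) / 3)) 75,
        ← Real.rpow_mul (by norm_num), ← Real.rpow_natCast ((3 : ℝ) ^ ((24 : ℝ) / 25)) 75,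
        ← Real.rpow_mul (by norm_num),
        show ((8 : ℝ) / 3 * ((75 : ℕ) : ℝ)) = ((200 : ℕ) : ℝ) by norm_num,
        show ((24 : ℝ) / 25 * ((75 : ℕ) : ℝ)) = ((72 : ℕ) : ℝ) by norm_num,
        Real.rpow_natCast, Real.rpow_natCast]
      norm_num
    have := le_of_pow_le_pow_left₀ (by norm_num) (by positivity) h75
    exact this

/-- **Exponent `3m'`, `gcd(3, m') = 1`, group level:** `|S| = a t`, `a = |S_3|`, and every twisted
matching under any finite family of automorphism-pair twists has `|ι| ≤ 3 t a^{14/15}`. [this work] -/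
theorem twistedMatching_card_le_exp_three_mul (m' : ℕ) (hm' : Nat.Coprime 3 m') (S : Type)
    [CommGroup S] [Fintype S] [DecidableEq S] (hexpS : ∀ g : S, g ^ (3 * m') = 1)
    (σ : Type) [Fintype σ] (φ ψ : σ → S ≃* S) (ι : Type) [Fintype ι] (x y z : ι → S)
    (hmatch : ∀ i j l : ι, (∃ s : σ, x i * φ s (y j) * ψ s (z l) = 1) ↔ (i = j ∧ j = l)) :
    ∃ a t : ℕ, Fintype.card S = a * t ∧ Nat.Coprime 3 t ∧ (∃ k : ℕ, a = 3 ^ k) ∧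
      (Fintype.card ι : ℝ) ≤ 3 * (t : ℝ) * (a : ℝ) ^ (14 / 15 : ℝ) := by
  haveI : Fact (Nat.Prime 3) := ⟨Nat.prime_three⟩
  exact twistedMatching_card_le_effective_of_exponent 3 1 m' hm' (3 / 5) (14 / 15) (by norm_num)
    (by norm_num) levelCond_three_one S (fun g => by simpa using hexpS g) σ φ ψ ι x y z hmatch

/-- **Exponent `3m'`, `gcd(3, m') = 1`, translation schemes:** a CU13 Def. 11/12 realization of
`⟨3N,3N,3N⟩` in `𝒮(S, M₀)` forces `|S| = a t` (`a = |S_3|`), `N² e^{-4√(log N)} ≤ 3 t a^{14/15}`,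
`a t ≤ |C|·|M₀|`. [this work] -/
theorem translationScheme_exp_three_mul (m' : ℕ) (hm' : Nat.Coprime 3 m') (S : Type) [CommGroup S]
    [Fintype S] [DecidableEq S] (hexpS : ∀ g : S, g ^ (3 * m') = 1)
    (M₀ : Subgroup (MulAut S)) [Fintype M₀] (C : Type) [Fintype C] [DecidableEq C] (c : S → C)
    (hc : ∀ g h : S, c g = c h ↔ ∃ φ : M₀, (φ : MulAut S) g = h) (N : ℕ)
    (A B Γ : Fin (3 * N) × Fin (3 * N) → C)
    (hreal : ∀ x y z : Fin (3 * N) × Fin (3 * N),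
      (∃ g h l : S, c g = A x ∧ c h = B y ∧ c l = Γ z ∧ g * h * l = 1) ↔
        (y.1 = x.2 ∧ z = (y.2, x.1))) :
    ∃ a t : ℕ, Fintype.card S = a * t ∧ Nat.Coprime 3 t ∧ (∃ k : ℕ, a = 3 ^ k) ∧
      ((N : ℝ) ^ 2 * Real.exp (-4 * Real.sqrt (Real.log N))) ≤
        3 * (t : ℝ) * (a : ℝ) ^ (14 / 15 : ℝ) ∧
      a * t ≤ Fintype.card C * Fintype.card M₀ := by
  haveI : Fact (Nat.Prime 3) := ⟨Nat.prime_three⟩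
  exact translationScheme_effective_of_exponent 3 1 m' hm' (3 / 5) (14 / 15) (by norm_num)
    (by norm_num) levelCond_three_one S (fun g => by simpa using hexpS g) M₀ C c hc N A B Γ hreal

/-- **Exponent `4m'`, `gcd(2, m') = 1`, group level:** `|S| = a t`, `a = |S_2|`, and every twisted
matching under any finite family of automorphism-pair twists has `|ι| ≤ 3 t a^{19/20}`. [this work] -/
theorem twistedMatching_card_le_exp_four_mul (m' : ℕ) (hm' : Nat.Coprime 2 m') (S : Type)
    [CommGroup S] [Fintype S] [DecidableEq S] (hexpS : ∀ g : S, g ^ (4 * m') = 1)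
    (σ : Type) [Fintype σ] (φ ψ : σ → S ≃* S) (ι : Type) [Fintype ι] (x y z : ι → S)
    (hmatch : ∀ i j l : ι, (∃ s : σ, x i * φ s (y j) * ψ s (z l) = 1) ↔ (i = j ∧ j = l)) :
    ∃ a t : ℕ, Fintype.card S = a * t ∧ Nat.Coprime 2 t ∧ (∃ k : ℕ, a = 2 ^ k) ∧
      (Fintype.card ι : ℝ) ≤ 3 * (t : ℝ) * (a : ℝ) ^ (19 / 20 : ℝ) := by
  haveI : Fact (Nat.Prime 2) := ⟨Nat.prime_two⟩
  exact twistedMatching_card_le_effective_of_exponent 2 2 m' hm' (3 / 4) (19 / 20) (by norm_num)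
    (by norm_num) levelCond_two_two S (fun g => by simpa using hexpS g) σ φ ψ ι x y z hmatch

/-- **Exponent `4m'`, `gcd(2, m') = 1`, translation schemes:** a CU13 Def. 11/12 realization of
`⟨3N,3N,3N⟩` in `𝒮(S, M₀)` forces `|S| = a t` (`a = |S_2|`), `N² e^{-4√(log N)} ≤ 3 t a^{19/20}`,
`a t ≤ |C|·|M₀|`. [this work] -/
theorem translationScheme_exp_four_mul (m' : ℕ) (hm' : Nat.Coprime 2 m') (S : Type) [CommGroup S]
    [Fintype S] [DecidableEq S] (hexpS : ∀ g : S, g ^ (4 * m') = 1)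
    (M₀ : Subgroup (MulAut S)) [Fintype M₀] (C : Type) [Fintype C] [DecidableEq C] (c : S → C)
    (hc : ∀ g h : S, c g = c h ↔ ∃ φ : M₀, (φ : MulAut S) g = h) (N : ℕ)
    (A B Γ : Fin (3 * N) × Fin (3 * N) → C)
    (hreal : ∀ x y z : Fin (3 * N) × Fin (3 * N),
      (∃ g h l : S, c g = A x ∧ c h = B y ∧ c l = Γ z ∧ g * h * l = 1) ↔
        (y.1 = x.2 ∧ z = (y.2, x.1))) :
    ∃ a t : ℕ, Fintype.card S = a * t ∧ Nat.Coprime 2 t ∧ (∃ k : ℕ, a = 2 ^ k) ∧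
      ((N : ℝ) ^ 2 * Real.exp (-4 * Real.sqrt (Real.log N))) ≤
        3 * (t : ℝ) * (a : ℝ) ^ (19 / 20 : ℝ) ∧
      a * t ≤ Fintype.card C * Fintype.card M₀ := by
  haveI : Fact (Nat.Prime 2) := ⟨Nat.prime_two⟩
  exact translationScheme_effective_of_exponent 2 2 m' hm' (3 / 4) (19 / 20) (by norm_num)
    (by norm_num) levelCond_two_two S (fun g => by simpa using hexpS g) M₀ C c hc N A B Γ hreal

/-- **Exponent `5m'`, `gcd(5, m') = 1`, group level:** `|S| = a t`, `a = |S_5|`, and every twisted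
matching under any finite family of automorphism-pair twists has `|ι| ≤ 3 t a^{15/16}`. [this work] -/
theorem twistedMatching_card_le_exp_five_mul (m' : ℕ) (hm' : Nat.Coprime 5 m') (S : Type)
    [CommGroup S] [Fintype S] [DecidableEq S] (hexpS : ∀ g : S, g ^ (5 * m') = 1)
    (σ : Type) [Fintype σ] (φ ψ : σ → S ≃* S) (ι : Type) [Fintype ι] (x y z : ι → S)
    (hmatch : ∀ i j l : ι, (∃ s : σ, x i * φ s (y j) * ψ s (z l) = 1) ↔ (i = j ∧ j = l)) :
    ∃ a t : ℕ, Fintype.card S = a * t ∧ Nat.Coprime 5 t ∧ (∃ k : ℕ, a = 5 ^ k) ∧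
      (Fintype.card ι : ℝ) ≤ 3 * (t : ℝ) * (a : ℝ) ^ (15 / 16 : ℝ) := by
  haveI : Fact (Nat.Prime 5) := ⟨Nat.prime_five⟩
  exact twistedMatching_card_le_effective_of_exponent 5 1 m' hm' (7 / 10) (15 / 16) (by norm_num)
    (by norm_num) levelCond_five_one S (fun g => by simpa using hexpS g) σ φ ψ ι x y z hmatch

/-- **Exponent `5m'`, `gcd(5, m') = 1`, translation schemes:** a CU13 Def. 11/12 realization of
`⟨3N,3N,3N⟩` in `𝒮(S, M₀)` forces `|S| = a t` (`a = |S_5|`), `N² e^{-4√(log N)} ≤ 3 t a^{15/16}`,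
`a t ≤ |C|·|M₀|`. [this work] -/
theorem translationScheme_exp_five_mul (m' : ℕ) (hm' : Nat.Coprime 5 m') (S : Type) [CommGroup S]
    [Fintype S] [DecidableEq S] (hexpS : ∀ g : S, g ^ (5 * m') = 1)
    (M₀ : Subgroup (MulAut S)) [Fintype M₀] (C : Type) [Fintype C] [DecidableEq C] (c : S → C)
    (hc : ∀ g h : S, c g = c h ↔ ∃ φ : M₀, (φ : MulAut S) g = h) (N : ℕ)
    (A B Γ : Fin (3 * N) × Fin (3 * N) → C)
    (hreal : ∀ x y z : Fin (3 * N) × Fin (3 * N),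
      (∃ g h l : S, c g = A x ∧ c h = B y ∧ c l = Γ z ∧ g * h * l = 1) ↔
        (y.1 = x.2 ∧ z = (y.2, x.1))) :
    ∃ a t : ℕ, Fintype.card S = a * t ∧ Nat.Coprime 5 t ∧ (∃ k : ℕ, a = 5 ^ k) ∧
      ((N : ℝ) ^ 2 * Real.exp (-4 * Real.sqrt (Real.log N))) ≤
        3 * (t : ℝ) * (a : ℝ) ^ (15 / 16 : ℝ) ∧
      a * t ≤ Fintype.card C * Fintype.card M₀ := by
  haveI : Fact (Nat.Prime 5) := ⟨Nat.prime_five⟩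
  exact translationScheme_effective_of_exponent 5 1 m' hm' (7 / 10) (15 / 16) (by norm_num)
    (by norm_num) levelCond_five_one S (fun g => by simpa using hexpS g) M₀ C c hc N A B Γ hreal

/-- **Exponent `9m'`, `gcd(3, m') = 1`, group level:** `|S| = a t`, `a = |S_3|`, and every twisted
matching under any finite family of automorphism-pair twists has `|ι| ≤ 3 t a^{24/25}`. [this work] -/
theorem twistedMatching_card_le_exp_nine_mul (m' : ℕ) (hm' : Nat.Coprime 3 m') (S : Type)
    [CommGroup S] [Fintype S] [DecidableEq S] (hexpS : ∀ g : S, g ^ (9 * m') = 1)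
    (σ : Type) [Fintype σ] (φ ψ : σ → S ≃* S) (ι : Type) [Fintype ι] (x y z : ι → S)
    (hmatch : ∀ i j l : ι, (∃ s : σ, x i * φ s (y j) * ψ s (z l) = 1) ↔ (i = j ∧ j = l)) :
    ∃ a t : ℕ, Fintype.card S = a * t ∧ Nat.Coprime 3 t ∧ (∃ k : ℕ, a = 3 ^ k) ∧
      (Fintype.card ι : ℝ) ≤ 3 * (t : ℝ) * (a : ℝ) ^ (24 / 25 : ℝ) := by
  haveI : Fact (Nat.Prime 3) := ⟨Nat.prime_three⟩
  exact twistedMatching_card_le_effective_of_exponent 3 2 m' hm' (4 / 5) (24 / 25) (by norm_num)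
    (by norm_num) levelCond_three_two S (fun g => by simpa using hexpS g) σ φ ψ ι x y z hmatch

/-- **Exponent `9m'`, `gcd(3, m') = 1`, translation schemes:** a CU13 Def. 11/12 realization of
`⟨3N,3N,3N⟩` in `𝒮(S, M₀)` forces `|S| = a t` (`a = |S_3|`), `N² e^{-4√(log N)} ≤ 3 t a^{24/25}`,
`a t ≤ |C|·|M₀|`. [this work] -/
theorem translationScheme_exp_nine_mul (m' : ℕ) (hm' : Nat.Coprime 3 m') (S : Type) [CommGroup S]
    [Fintype S] [DecidableEq S] (hexpS : ∀ g : S, g ^ (9 * m') = 1)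
    (M₀ : Subgroup (MulAut S)) [Fintype M₀] (C : Type) [Fintype C] [DecidableEq C] (c : S → C)
    (hc : ∀ g h : S, c g = c h ↔ ∃ φ : M₀, (φ : MulAut S) g = h) (N : ℕ)
    (A B Γ : Fin (3 * N) × Fin (3 * N) → C)
    (hreal : ∀ x y z : Fin (3 * N) × Fin (3 * N),
      (∃ g h l : S, c g = A x ∧ c h = B y ∧ c l = Γ z ∧ g * h * l = 1) ↔
        (y.1 = x.2 ∧ z = (y.2, x.1))) :
    ∃ a t : ℕ, Fintype.card S = a * t ∧ Nat.Coprime 3 t ∧ (∃ k : ℕ, a = 3 ^ k) ∧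
      ((N : ℝ) ^ 2 * Real.exp (-4 * Real.sqrt (Real.log N))) ≤
        3 * (t : ℝ) * (a : ℝ) ^ (24 / 25 : ℝ) ∧
      a * t ≤ Fintype.card C * Fintype.card M₀ := by
  haveI : Fact (Nat.Prime 3) := ⟨Nat.prime_three⟩
  exact translationScheme_effective_of_exponent 3 2 m' hm' (4 / 5) (24 / 25) (by norm_num)
    (by norm_num) levelCond_three_two S (fun g => by simpa using hexpS g) M₀ C c hc N A B Γ hreal

end EffectiveTable

end Summit.MatrixMultiplication.MatrixMultiplication.Theorems.TwistedSliceRank
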